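/-
Copyright (c) 2026 the pub-hodgecm-mathlib formalisation cell (harness21).  Prover seat hodgecm-mathlib-K2E1-p12 (g5), Track B ∕ K2-LIT, h413 = `stmt-HodgeConjecture-24833`,
R90-TF section S8 «ContSpec-n½», sub-socket (R), letter L2 (S8 dealer R90-CS-plan (g3), 2026-09-04T23:58Z «(b) + NEXT»): the operator-road letter `hOP` of ★ p863331 OF LETTERS —
`hOP` from the ROAD letter (truncated continued family + Maass–Selberg bound) and the CONSTANT-TERM letter, every composition step ★ and cited by name.
-/
import Summits.HodgeConjecture.HodgeConjecture.Theorems.R90S8ResGMidBlockLeResidualOfLettersU3      -- ★ p863331 (this seat): `res_midBlock_le_residual_of_letters`, `hcuspLetters_of_operatorRoad`, `hdisc_of_admissible` (+ ★ p862884, ★ p863227, ★ p863180)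
import Summits.HodgeConjecture.HodgeConjecture.Theorems.K2E1ChiContinuedEisensteinMiddleResidueCMThree -- ★ p862783 (K2E1-p16) T-hr2: `exists_L2Residue_of_section` (the `L²` residue of `Λ^T Ẽ` exists from `hMS` and is `r − tail_T` a.e.)
import Summits.HodgeConjecture.HodgeConjecture.Theorems.R90S8SiegelTopCorrectionCuspOrthogonalU3     -- ★ p863083 (R90-C133-p02) (d): `inner_cuspFormsToLp_eq_zero_of_ae_eq_siegelTail_cm_three`
import Summits.HodgeConjecture.HodgeConjecture.Theorems.R90S8ResGMidAtomArchStableU3                -- ★ p863205 (K2E1-p11): `midContinuation_quotientSubgroup_mul` (left `G(F)`-invariance of the continued family)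
import Summits.HodgeConjecture.HodgeConjecture.Theorems.K2E1BLHeightCosetsU3                          -- ★ (K2E1-p09): `exists_forall_borelHeight_mul_le` (`w₁` is attained: the maximiser selector)
import HarnessLib

/-!
# S8 sub-socket (R), letter L2 — `R90S8ResGMidBlockOperatorRoadOfLettersU3`: THE OPERATOR-ROAD LETTER `hOP` OF ★ p863331 FROM THE ROAD LETTER AND THE CONSTANT-TERM LETTER

Track B ∕ R90-TF, crux h413 = `stmt-HodgeConjecture-24833`, route of record `HCCMUnconditional`; cell `hodgecm-mathlib`, section S8 «ContSpec-n½», sub-socket (R)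
`sock_S8_res_midBlock_le_residual` (B ED. 5∕6 :284; (R)′ with `Nonempty 𝔓.ι` for ED. 7, audit1 A6).  THEOREMS ONLY (no `def`, no `instance`, no `notation`, no named-fact hypothesis, no
`sorry`; default heartbeats); lane `--supports stmt-HodgeConjecture-24833 --as helper` (count-neutral).  CLOSES NO SOCKET.  ★ p863331 made (R)′ «★ modulo L1 (`hDISC`) + L2 (`hOP`)»;
this file makes L2 «★ modulo ℓ-ROAD + ℓ-CT» — the two genuinely analytic letters of the road, named with owners — and re-exports (R)′ over {L1, ℓ-ROAD, ℓ-CT} (§3), so the (V)∕(E)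
assemblies (K2E2-p12, K2E1-p14) and the payers plug BY NAME.

THE MATHEMATICS ([MoeglinWaldspurger1995, I.2.13, I.2.18, IV.1.9–IV.1.11, V.3.13]; [Langlands1976, §7]; [BernsteinLapid2019, §4]).  Fix a generator of the middle-pole residue atom
(★ D1: a continuous pair-section `φ` of the `φ_ξ`-block, THE continued family `Ec` on `{1 < Re} ∖ Sp`, a pole letter `Fp` at `3∕2`, the class `f =ᵐ x ↦ Fp(x̃⁻¹)(3∕2)`) and a Heisenberg
package `(ν, 𝓕)`.  ℓ-ROAD gives the truncated continued family as an `L²`-valued map `Fam`, holomorphic on an open preconnected `D ⊆ {1<Re}∖Sp` reaching a real tube point `σ₀ > 2` and a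
punctured neighbourhood of `3∕2`, with `Fam z =ᵐ Λ^T Ec(z)` and the Maass–Selberg bound `‖(z − 3∕2)•Fam z‖ ≤ C` near `3∕2`.  ℓ-CT gives the constant term of the continued family in the
shape `(Ec z)_B = φ₀·H^z + ψ_z·H^{2−z}` with the residue `(z − 3∕2)ψ_z → ρψ` and the profile properties of `ψt := ρψ·H^{1∕2}` (measurable, left-`B(F)`- and left-`N(𝔸)`-invariant,
`‖ψt‖ ≤ K·H^{1∕2}`).  THEN (★ p862783 §4, with `hEcinv` from ★ p863205 and a maximiser selector `γ₀` from ★ `exists_forall_borelHeight_mul_le`) the `L²` residue `Res := lim (z − 3∕2)•Fam z`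
EXISTS and `Res =ᵐ Fp(ỹ)(3∕2) − 𝟙[T < w₁]·ψt(γ₀ỹ·ỹ)`; so with **`corr := f − Res`**: (b)(c) `(z − 3∕2)•Fam z + corr → Res + (f − Res) = f`, and `corr =ᵐ` the Siegel tail, whence (d)
`⟪φ̂, corr⟫ = 0` for every cusp form (★ p863083).  That is the `hOP` package `(T, D, σ₀, Fam, corr)` — with the one shape delta of (R)′: (d) needs an index `i : 𝔓.ι` (FLAG ③ = FLAG ①).
* §1 **`opRoadPackage_of_letters`** — ONE generator, all data explicit: ROAD data + CT data ⊢ ★ p863331's `∃ (T ≥ 1) D σ₀ Fam corr, …` package (`corr := f − Res`).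
* §2 HEAD **`hOP_of_letters (hROAD) (hCT)`** — the `hOP` bytes of ★ p863331 with `(hne : Nonempty 𝔓.ι)` inserted after `h𝔓` (as in (R)′), from the two closed letters ℓ-ROAD, ℓ-CT.
* §3 **`res_midBlock_le_residual_of_letters'` `(hDISC) (hROAD) (hCT)`** — (R)′'s statement (★ p863331's conclusion bytes) over {L1, ℓ-ROAD, ℓ-CT} (★ p863331's spine with §2 as `hop`).
THE TWO LETTERS (closed, quantified over (R)′'s frame, D1's clause names, the class `(f, hf)` and every Heisenberg package `(ν, 𝓕)` — exactly `hOP`'s frame):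
* ℓ-ROAD `hROAD` — `∃ (T ≥ 1) (D ⊆ {1<Re}∖Sp open preconnected, ∋ nbhd σ₀ > 2, ⊇ pnbhd 3∕2) σ₀ (Fam holomorphic on D, =ᵐ Λ^T_{ν,𝓕} Ec z) + hMS`; owner the T1 ∕ Maass–Selberg chain
  (★ p863279 tube formula → ★ p862892 `msRel_of_tube_letters` → ★ p862829 `msBound_middlePole_of_chiRelation` reduce `hMS` to `hdec′` + the three-scalar analytic letters; the continuation
  of `Fam` below `Re = 2` is the same road's).
* ℓ-CT `hCT` — `∃ φ₀ ψ ρψ`: CT shape on `{1<Re}∖Sp`, residue of `ψ` at `3∕2`, profile clauses of `ψt`; owner the constant-term ∕ scattering road (★ p862836 §1 consumes exactly `hE3 hψ`; ★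
  p862860 pays `hψ` from `hfac : ψ = qc·φ̃` + ★ F5; the shape on `{2<Re}` is ★ `borelConstantTerm_chiPairEisenstein_cm_three_eq_add_mul`, its continuation below `2` = the scattering operator's
  at level `(K′, ω)` — (a-2b) ∕ F5 ∕ M1 scalar ★ p862428).
HONEST LABEL: HC_CM is proved only modulo the 7 printed citations (2 remaining named inputs: hLiu418 = `stmt-HodgeConjecture-24832`, h413 = `stmt-HodgeConjecture-24833`) until
rung 0 closes; REL ≠ ★ ≠ BUILT; this file asserts no named fact, is conditional by construction on ℓ-ROAD + ℓ-CT (+ L1 in §3), and closes no socket; count-neutral.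

## References
* [MoeglinWaldspurger1995] C. Mœglin, J.-L. Waldspurger, *Spectral Decomposition and Eisenstein Series* (1995), I.2.13, I.2.18, IV.1.9–IV.1.11, V.3.13.
* [Langlands1976] R. P. Langlands, *On the Functional Equations Satisfied by Eisenstein Series*, LNM 544 (1976), §7.
* [BernsteinLapid2019] J. Bernstein, E. Lapid, *On the meromorphic continuation of Eisenstein series*, J. Amer. Math. Soc. 37 (2024), §4.
* [Rogawski1990] J. D. Rogawski, *Automorphic Representations of Unitary Groups in Three Variables* (1990), §13.9 p. 229 (ii).
-/

set_option autoImplicit false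
set_option linter.dupNamespace false  -- the mandated namespace `…HodgeConjecture.HodgeConjecture.R90.S8` (LEAD #1 L1) repeats the summit's segment

noncomputable section

open MeasureTheory Measure Set Filter Topology NumberField IsDedekindDomain ContRepresentation
open scoped ENNReal NNReal InnerProductSpace Topology
open Literature.NumberTheory.Automorphic Literature.NumberTheory.Automorphic.UnitaryGroup Literature.NumberTheory.GaloisRepresentations AdelicGroupData
open Literature.NumberTheory.Automorphic.Arthur2013.Leaves.TECR Literature.NumberTheory.Rogawski1990
open Summit.HodgeConjecture.HodgeConjecture.Cruxes.H413.K2E1BorelEisensteinU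
open Summit.HodgeConjecture.HodgeConjecture.Cruxes.H413.K2E1ChiSectionSpaceU3PairDefs
open Summit.HodgeConjecture.HodgeConjecture.Cruxes.H413.K2E1BLBorelSpacesU2Defs
open Summit.HodgeConjecture.HodgeConjecture.Cruxes.H413.K2E1CuspidalSpectrumUnitary (residualSubspace)
open Summit.HodgeConjecture.HodgeConjecture.Cruxes.H413.K2E1SphericalEisensteinStructuralDataCMThree (exists_unipotent_haar_fundamentalDomain_cm_three)
open Summit.HodgeConjecture.HodgeConjecture.Cruxes.H413.K2E1ChiContinuedEisensteinMiddleResidueCMThree (exists_L2Residue_of_section)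
open Summit.HodgeConjecture.HodgeConjecture.Cruxes.H413.K2E1BLHeightCosetsU3 (exists_forall_borelHeight_mul_le)

namespace Summit.HodgeConjecture.HodgeConjecture.R90.S8

/-! ## §1 One generator, all data explicit: ROAD data + CT data ⊢ ★ p863331's operator-road package with `corr := f − Res` -/

section OneGenerator

variable (L : Type) [Field L] [NumberField L] [IsCMField L]
  [MeasurableSpace (quasiSplit (↥(maximalRealSubfield L)) L (IsCMField.complexConj L) 3).Adelic] [BorelSpace (quasiSplit (↥(maximalRealSubfield L)) L (IsCMField.complexConj L) 3).Adelic]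
  (μ : Measure (quasiSplit (↥(maximalRealSubfield L)) L (IsCMField.complexConj L) 3).automorphicQuotient) [(quasiSplit (↥(maximalRealSubfield L)) L (IsCMField.complexConj L) 3).IsAutomorphicMeasure μ]
  (𝔓 : (quasiSplit (↥(maximalRealSubfield L)) L (IsCMField.complexConj L) 3).ParabolicUnipotentData) (ξ : OneDimAutRepH L) (μω : HeckeCharacter L)

/-- **THE OPERATOR-ROAD PACKAGE OF ONE GENERATOR FROM ITS ROAD DATA AND ITS CONSTANT-TERM DATA.**  In: an index `i` with `𝔓.radical i = N(𝔸)`; D1's clauses of a generator (`φ`, `Ec` on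
`{1<Re}∖Sp` — `Sp` real —, pole letter `Fp` at `3∕2`, the class `f`); a Heisenberg package `(ν, 𝓕)`; ROAD DATA `(T ≥ 1, D, σ₀, Fam)` (open, preconnected, `D ⊆ {1<Re}∖Sp`, holomorphic,
`σ₀ > 2` inside, punctured `3∕2` inside, `Fam z =ᵐ Λ^T Ec z`, Maass–Selberg bound `hMS`); CT DATA `(φ₀, ψ, ρψ)` (shape of `(Ec z)_B` on `{1<Re}∖Sp`, residue `hψ` at `3∕2`, profile clauses of
`ψt = ρψ·H^{1∕2}`).  Out: ★ p863331's package with `F := Fam` and **`corr := f − Res`**, `Res` the `L²` residue of ★ `exists_L2Residue_of_section` (`hEcinv` by ★ `midContinuation_quotientSubgroup_mul`,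
`γ₀` by ★ `exists_forall_borelHeight_mul_le`): (b)(c) `(z − 3∕2)•Fam z + corr → f`; (d) by ★ `inner_cuspFormsToLp_eq_zero_of_ae_eq_siegelTail_cm_three` since `corr =ᵐ 𝟙[T<w₁]·ψt(γ₀ỹ·ỹ)`.
[cite: MoeglinWaldspurger1995, I.2.13, IV.1.11, V.3.13] [cite: Langlands1976, §7] [cite: BernsteinLapid2019, §4] -/
theorem opRoadPackage_of_letters (i : 𝔓.ι) (h𝔓 : 𝔓.radical i = adelicUnipotent (↥(maximalRealSubfield L)) L (IsCMField.complexConj L) 3)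
    {K' : Subgroup (quasiSplit (↥(maximalRealSubfield L)) L (IsCMField.complexConj L) 3).Adelic} {ω : ↥K' →* ℂ}
    {φ : (quasiSplit (↥(maximalRealSubfield L)) L (IsCMField.complexConj L) 3).Adelic → ℂ} (hφV : φ ∈ chiSectionSpacePair (ξ.bcη⁻¹ * ξ.bcψ⁻¹ * μω) ξ.ψ K' (ω : ↥K' → ℂ))
    (Ec : ℂ → (quasiSplit (↥(maximalRealSubfield L)) L (IsCMField.complexConj L) 3).Adelic → ℂ) {Sp : Finset ℂ} (hSp : ∀ s ∈ Sp, s.im = 0 ∧ 1 < s.re ∧ s.re ≤ 2)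
    (hhol : ∀ g, DifferentiableOn ℂ (fun z => Ec z g) ({z : ℂ | 1 < z.re} \ (↑Sp : Set ℂ))) (hEis : ∀ z : ℂ, 2 < z.re → Ec z = eisensteinSeriesU (flatSectionU φ z))
    (Fp : (quasiSplit (↥(maximalRealSubfield L)) L (IsCMField.complexConj L) 3).Adelic → ℂ → ℂ) (hFp : ∀ g, AnalyticAt ℂ (Fp g) ((3 : ℂ) / 2)) (hFpE : ∀ g, Fp g =ᶠ[𝓝[≠] ((3 : ℂ) / 2)] fun z => (z - (3 : ℂ) / 2) * Ec z g)
    (f : (quasiSplit (↥(maximalRealSubfield L)) L (IsCMField.complexConj L) 3).L2 μ) (hf : (f : (quasiSplit (↥(maximalRealSubfield L)) L (IsCMField.complexConj L) 3).automorphicQuotient → ℂ) =ᵐ[μ] fun x => Fp (Quotient.out (x : (quasiSplit (↥(maximalRealSubfield L)) L (IsCMField.complexConj L) 3).Adelic ⧸ (quasiSplit (↥(maximalRealSubfield L)) L (IsCMField.complexConj L) 3).quotientSubgroup))⁻¹ ((3 : ℂ) / 2))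
    (ν : Measure ↥(adelicUnipotent (↥(maximalRealSubfield L)) L (IsCMField.complexConj L) 3)) [ν.IsHaarMeasure] {𝓕 : Set ↥(adelicUnipotent (↥(maximalRealSubfield L)) L (IsCMField.complexConj L) 3)} (h𝓕N : IsFundamentalDomain ↥(rationalUnipotent (↥(maximalRealSubfield L)) L (IsCMField.complexConj L) 3) 𝓕 ν) (h𝓕c : IsCompact (closure 𝓕))
    -- ROAD data
    {T : ℝ≥0} (hT : 1 ≤ T) {D : Set ℂ} {σ₀ : ℝ} (Fam : ℂ → (quasiSplit (↥(maximalRealSubfield L)) L (IsCMField.complexConj L) 3).L2 μ) (hDo : IsOpen D) (hDc : IsPreconnected D) (hDsub : D ⊆ ({z : ℂ | 1 < z.re} \ (↑Sp : Set ℂ))) (hFd : DifferentiableOn ℂ Fam D)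
    (hσ₀ : 2 < σ₀) (hσD : ∀ᶠ z in 𝓝 ((σ₀ : ℝ) : ℂ), z ∈ D) (hD32 : ∀ᶠ z in 𝓝[≠] ((3 : ℂ) / 2), z ∈ D)
    (hFam : ∀ z ∈ D, ((Fam z : (quasiSplit (↥(maximalRealSubfield L)) L (IsCMField.complexConj L) 3).L2 μ) : (quasiSplit (↥(maximalRealSubfield L)) L (IsCMField.complexConj L) 3).automorphicQuotient → ℂ) =ᵐ[μ] (quasiSplit (↥(maximalRealSubfield L)) L (IsCMField.complexConj L) 3).quotFun (truncation ν 𝓕 T (Ec z)))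
    (hMS : ∃ C : ℝ, ∀ᶠ z in 𝓝[≠] ((3 : ℂ) / 2), ‖(z - (3 : ℂ) / 2) • Fam z‖ ≤ C)
    -- CT data
    (φ₀ : (quasiSplit (↥(maximalRealSubfield L)) L (IsCMField.complexConj L) 3).Adelic → ℂ) (ψ : ℂ → (quasiSplit (↥(maximalRealSubfield L)) L (IsCMField.complexConj L) 3).Adelic → ℂ) (ρψ : (quasiSplit (↥(maximalRealSubfield L)) L (IsCMField.complexConj L) 3).Adelic → ℂ)
    (hE3 : ∀ z ∈ ({z : ℂ | 1 < z.re} \ (↑Sp : Set ℂ)), ∀ g : (quasiSplit (↥(maximalRealSubfield L)) L (IsCMField.complexConj L) 3).Adelic,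
      borelConstantTerm ν 𝓕 (Ec z) g = φ₀ g * (((borelHeight g : ℝ≥0) : ℝ) : ℂ) ^ z + ψ z g * (((borelHeight g : ℝ≥0) : ℝ) : ℂ) ^ (2 - z))
    (hψ : ∀ g, Tendsto (fun z : ℂ => (z - (3 : ℂ) / 2) * ψ z g) (𝓝[≠] ((3 : ℂ) / 2)) (𝓝 (ρψ g)))
    (hψm : Measurable (fun g : (quasiSplit (↥(maximalRealSubfield L)) L (IsCMField.complexConj L) 3).Adelic => ρψ g * (((borelHeight g : ℝ≥0) : ℝ) : ℂ) ^ (2 - (3 : ℂ) / 2)))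
    (hψB : ∀ b ∈ arithmeticBorel (↥(maximalRealSubfield L)) L (IsCMField.complexConj L) 3, ∀ x : (quasiSplit (↥(maximalRealSubfield L)) L (IsCMField.complexConj L) 3).Adelic, (fun g : (quasiSplit (↥(maximalRealSubfield L)) L (IsCMField.complexConj L) 3).Adelic => ρψ g * (((borelHeight g : ℝ≥0) : ℝ) : ℂ) ^ (2 - (3 : ℂ) / 2)) ((b : (quasiSplit (↥(maximalRealSubfield L)) L (IsCMField.complexConj L) 3).Adelic) * x) = (fun g : (quasiSplit (↥(maximalRealSubfield L)) L (IsCMField.complexConj L) 3).Adelic => ρψ g * (((borelHeight g : ℝ≥0) : ℝ) : ℂ) ^ (2 - (3 : ℂ) / 2)) x)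
    (hψN : ∀ (u : ↥(adelicUnipotent (↥(maximalRealSubfield L)) L (IsCMField.complexConj L) 3)) (g : (quasiSplit (↥(maximalRealSubfield L)) L (IsCMField.complexConj L) 3).Adelic), (fun g : (quasiSplit (↥(maximalRealSubfield L)) L (IsCMField.complexConj L) 3).Adelic => ρψ g * (((borelHeight g : ℝ≥0) : ℝ) : ℂ) ^ (2 - (3 : ℂ) / 2)) ((u : (quasiSplit (↥(maximalRealSubfield L)) L (IsCMField.complexConj L) 3).Adelic) * g) = (fun g : (quasiSplit (↥(maximalRealSubfield L)) L (IsCMField.complexConj L) 3).Adelic => ρψ g * (((borelHeight g : ℝ≥0) : ℝ) : ℂ) ^ (2 - (3 : ℂ) / 2)) g)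
    {K : ℝ} (hψK : ∀ g : (quasiSplit (↥(maximalRealSubfield L)) L (IsCMField.complexConj L) 3).Adelic, ‖(fun g : (quasiSplit (↥(maximalRealSubfield L)) L (IsCMField.complexConj L) 3).Adelic => ρψ g * (((borelHeight g : ℝ≥0) : ℝ) : ℂ) ^ (2 - (3 : ℂ) / 2)) g‖ ≤ K * ((borelHeight g : ℝ≥0) : ℝ) ^ (1 / 2 : ℝ)) :
    ∃ (T : ℝ≥0) (_ : 1 ≤ T) (D : Set ℂ) (σ₀ : ℝ) (Fam : ℂ → (quasiSplit (↥(maximalRealSubfield L)) L (IsCMField.complexConj L) 3).L2 μ) (corr : (quasiSplit (↥(maximalRealSubfield L)) L (IsCMField.complexConj L) 3).L2 μ),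
        IsOpen D ∧ IsPreconnected D ∧ DifferentiableOn ℂ Fam D ∧ 2 < σ₀ ∧ (∀ᶠ z in 𝓝 ((σ₀ : ℝ) : ℂ), z ∈ D) ∧ (∀ᶠ z in 𝓝[≠] ((3 : ℂ) / 2), z ∈ D) ∧
        (∀ z ∈ D, ((Fam z : (quasiSplit (↥(maximalRealSubfield L)) L (IsCMField.complexConj L) 3).L2 μ) : (quasiSplit (↥(maximalRealSubfield L)) L (IsCMField.complexConj L) 3).automorphicQuotient → ℂ) =ᵐ[μ] (quasiSplit (↥(maximalRealSubfield L)) L (IsCMField.complexConj L) 3).quotFun (truncation ν 𝓕 T (Ec z))) ∧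
        Tendsto (fun z : ℂ => (z - (3 : ℂ) / 2) • Fam z + corr) (𝓝[≠] ((3 : ℂ) / 2)) (𝓝 f) ∧
        ∀ φc : ↥((quasiSplit (↥(maximalRealSubfield L)) L (IsCMField.complexConj L) 3).cuspForms μ 𝔓), ⟪(quasiSplit (↥(maximalRealSubfield L)) L (IsCMField.complexConj L) 3).cuspFormsToLp μ 𝔓 φc, corr⟫_ℂ = 0 := by
  -- left `G(F)`-invariance of the continued family on `D` (★ p863205; `Sp` is real)
  have hEcinv : ∀ z ∈ D, ∀ (γ : (quasiSplit (↥(maximalRealSubfield L)) L (IsCMField.complexConj L) 3).arithmeticSubgroup) (x : (quasiSplit (↥(maximalRealSubfield L)) L (IsCMField.complexConj L) 3).Adelic), Ec z ((γ : (quasiSplit (↥(maximalRealSubfield L)) L (IsCMField.complexConj L) 3).Adelic) * x) = Ec z x := fun z hz γ x =>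
    midContinuation_quotientSubgroup_mul L (isChiSectionPair_of_mem hφV) ξ.hψ (fun s hs => (hSp s hs).1) hhol hEis
      ((quasiSplit (↥(maximalRealSubfield L)) L (IsCMField.complexConj L) 3).arithmeticSubgroup_le_quotientSubgroup γ.2) x (hDsub hz)
  -- a maximiser selector for `γ ↦ H(γ·y)` (★ `exists_forall_borelHeight_mul_le`)
  obtain ⟨γ₀, hγ₀⟩ : ∃ γ₀ : (quasiSplit (↥(maximalRealSubfield L)) L (IsCMField.complexConj L) 3).Adelic → (quasiSplit (↥(maximalRealSubfield L)) L (IsCMField.complexConj L) 3).arithmeticSubgroup, ∀ (y : (quasiSplit (↥(maximalRealSubfield L)) L (IsCMField.complexConj L) 3).Adelic) (δ : (quasiSplit (↥(maximalRealSubfield L)) L (IsCMField.complexConj L) 3).arithmeticSubgroup),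
      borelHeight ((δ : (quasiSplit (↥(maximalRealSubfield L)) L (IsCMField.complexConj L) 3).Adelic) * y) ≤ borelHeight ((γ₀ y : (quasiSplit (↥(maximalRealSubfield L)) L (IsCMField.complexConj L) 3).Adelic) * y) :=
    ⟨fun y => Classical.choose (exists_forall_borelHeight_mul_le y), fun y δ => Classical.choose_spec (exists_forall_borelHeight_mul_le y) δ⟩
  -- ★ p862783 §4: the `L²` residue of the truncated continued family exists and is `r − tail_T` a.e.
  obtain ⟨Res, hRes, hResId⟩ := exists_L2Residue_of_section μ ν h𝓕N hT Ec hDo hD32 hEcinv φ₀ ψ ρψ hψ (fun z hz g => hE3 z (hDsub hz) g) Fp hFp hFpE γ₀ hγ₀ Fam hFd hFam hMS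
  -- the correction `corr := f − Res` IS the Siegel tail a.e.
  have hv : ((f - Res : (quasiSplit (↥(maximalRealSubfield L)) L (IsCMField.complexConj L) 3).L2 μ) : (quasiSplit (↥(maximalRealSubfield L)) L (IsCMField.complexConj L) 3).automorphicQuotient → ℂ) =ᵐ[μ] fun x =>
      if T < supHeight (↥(maximalRealSubfield L)) L (IsCMField.complexConj L) 3 x then (fun g : (quasiSplit (↥(maximalRealSubfield L)) L (IsCMField.complexConj L) 3).Adelic => ρψ g * (((borelHeight g : ℝ≥0) : ℝ) : ℂ) ^ (2 - (3 : ℂ) / 2)) ((γ₀ (Quotient.out (x : (quasiSplit (↥(maximalRealSubfield L)) L (IsCMField.complexConj L) 3).Adelic ⧸ (quasiSplit (↥(maximalRealSubfield L)) L (IsCMField.complexConj L) 3).quotientSubgroup))⁻¹ : (quasiSplit (↥(maximalRealSubfield L)) L (IsCMField.complexConj L) 3).Adelic) * (Quotient.out (x : (quasiSplit (↥(maximalRealSubfield L)) L (IsCMField.complexConj L) 3).Adelic ⧸ (quasiSplit (↥(maximalRealSubfield L)) L (IsCMField.complexConj L) 3).quotientSubgroup))⁻¹) else 0 := by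
    filter_upwards [Lp.coeFn_sub f Res, hf, hResId] with x h1 h2 h3
    rw [h1, Pi.sub_apply, h2, h3, sub_sub_cancel]
  refine ⟨T, hT, D, σ₀, Fam, f - Res, hDo, hDc, hFd, hσ₀, hσD, hD32, hFam, ?_, fun φc => ?_⟩
  · -- (b)(c): `(z − 3∕2)•Fam z + (f − Res) → Res + (f − Res) = f`
    have h := hRes.add (tendsto_const_nhds (x := f - Res))
    rwa [add_sub_cancel] at h
  · -- (d): ★ p863083 at the profile `ψt = ρψ·H^{1∕2}`
    exact inner_cuspFormsToLp_eq_zero_of_ae_eq_siegelTail_cm_three L μ ν h𝓕N h𝓕c 𝔓 i h𝔓 hT hψm hψB hψN (by norm_num : (1 / 2 : ℝ) < 1) hψK γ₀ hγ₀ (f - Res) hv φc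

end OneGenerator

/-! ## §2 HEAD: the `hOP` letter of ★ p863331 (with (R)′'s `Nonempty 𝔓.ι`) from the two closed letters ℓ-ROAD and ℓ-CT -/

/-- **L2 OF LETTERS — THE OPERATOR ROAD `hOP` FROM ℓ-ROAD AND ℓ-CT.**  CONCLUSION: the `hOP` binder bytes of ★ p863331 `res_midBlock_le_residual_of_letters`, with ONE shape delta — the
(R)′ binder `(hne : Nonempty 𝔓.ι)` inserted after `h𝔓` ((d) is false at `𝔓.ι = ∅`; audit1 A6).  HYPOTHESES: the closed letters ℓ-ROAD `hROAD` (truncated continued family `Fam` on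
`D ⊆ {1<Re}∖Sp` with `hFam` and the Maass–Selberg bound `hMS` at `3∕2`) and ℓ-CT `hCT` (constant-term shape `φ₀·H^z + ψ_z·H^{2−z}` of the continued family, residue of `ψ` at `3∕2`, profile
clauses of `ψt = ρψ·H^{1∕2}`), both quantified exactly like `hOP`.  PROOF: §1 per generator. [cite: MoeglinWaldspurger1995, I.2.13, IV.1.11, V.3.13] [cite: Langlands1976, §7] -/
theorem hOP_of_letters
    (hROAD : ∀ (L : Type) [Field L] [NumberField L] [IsCMField L]
      [MeasurableSpace (quasiSplit (↥(maximalRealSubfield L)) L (IsCMField.complexConj L) 3).Adelic] [BorelSpace (quasiSplit (↥(maximalRealSubfield L)) L (IsCMField.complexConj L) 3).Adelic]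
      (μ : Measure (quasiSplit (↥(maximalRealSubfield L)) L (IsCMField.complexConj L) 3).automorphicQuotient) [(quasiSplit (↥(maximalRealSubfield L)) L (IsCMField.complexConj L) 3).IsAutomorphicMeasure μ]
      (𝔓 : (quasiSplit (↥(maximalRealSubfield L)) L (IsCMField.complexConj L) 3).ParabolicUnipotentData) (_ : ∀ j : 𝔓.ι, 𝔓.radical j = adelicUnipotent (↥(maximalRealSubfield L)) L (IsCMField.complexConj L) 3)
      (μω : HeckeCharacter L) (_ : μω.IsUnitary)
      (_ : ∀ x : Literature.NumberTheory.GaloisRepresentations.ideleGroup ↥(maximalRealSubfield L),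
        μω (AdeleRing.ideleBaseChange (↥(maximalRealSubfield L)) L x) = quadraticHeckeCharCM L x)
      (ξ : OneDimAutRepH L) (K' : Subgroup (quasiSplit (↥(maximalRealSubfield L)) L (IsCMField.complexConj L) 3).Adelic) (ω : ↥K' →* ℂ)
      (φ : (quasiSplit (↥(maximalRealSubfield L)) L (IsCMField.complexConj L) 3).Adelic → ℂ) (_ : φ ∈ chiSectionSpacePair (ξ.bcη⁻¹ * ξ.bcψ⁻¹ * μω) ξ.ψ K' (ω : ↥K' → ℂ)) (_ : Continuous φ)
      (Ec : ℂ → (quasiSplit (↥(maximalRealSubfield L)) L (IsCMField.complexConj L) 3).Adelic → ℂ) (Sp : Finset ℂ) (_ : ∀ s ∈ Sp, s.im = 0 ∧ 1 < s.re ∧ s.re ≤ 2)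
      (_ : ∀ g, DifferentiableOn ℂ (fun z => Ec z g) ({z : ℂ | 1 < z.re} \ (↑Sp : Set ℂ)))
      (_ : ∀ z : ℂ, 2 < z.re → Ec z = eisensteinSeriesU (flatSectionU φ z))
      (Fp : (quasiSplit (↥(maximalRealSubfield L)) L (IsCMField.complexConj L) 3).Adelic → ℂ → ℂ) (_ : ∀ g, AnalyticAt ℂ (Fp g) ((3 : ℂ) / 2))
      (_ : ∀ g, Fp g =ᶠ[𝓝[≠] ((3 : ℂ) / 2)] fun z => (z - (3 : ℂ) / 2) * Ec z g)
      (f : (quasiSplit (↥(maximalRealSubfield L)) L (IsCMField.complexConj L) 3).L2 μ) (_ : (f : (quasiSplit (↥(maximalRealSubfield L)) L (IsCMField.complexConj L) 3).automorphicQuotient → ℂ) =ᵐ[μ] fun x => Fp (Quotient.out (x : (quasiSplit (↥(maximalRealSubfield L)) L (IsCMField.complexConj L) 3).Adelic ⧸ (quasiSplit (↥(maximalRealSubfield L)) L (IsCMField.complexConj L) 3).quotientSubgroup))⁻¹ ((3 : ℂ) / 2))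
      (ν : Measure ↥(adelicUnipotent (↥(maximalRealSubfield L)) L (IsCMField.complexConj L) 3)) (_ : ν.IsHaarMeasure) (𝓕 : Set ↥(adelicUnipotent (↥(maximalRealSubfield L)) L (IsCMField.complexConj L) 3)) (_ : IsFundamentalDomain ↥(rationalUnipotent (↥(maximalRealSubfield L)) L (IsCMField.complexConj L) 3) 𝓕 ν) (_ : IsCompact (closure 𝓕)),
      ∃ (T : ℝ≥0) (_ : 1 ≤ T) (D : Set ℂ) (σ₀ : ℝ) (Fam : ℂ → (quasiSplit (↥(maximalRealSubfield L)) L (IsCMField.complexConj L) 3).L2 μ),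
        IsOpen D ∧ IsPreconnected D ∧ D ⊆ ({z : ℂ | 1 < z.re} \ (↑Sp : Set ℂ)) ∧ DifferentiableOn ℂ Fam D ∧ 2 < σ₀ ∧ (∀ᶠ z in 𝓝 ((σ₀ : ℝ) : ℂ), z ∈ D) ∧ (∀ᶠ z in 𝓝[≠] ((3 : ℂ) / 2), z ∈ D) ∧
        (∀ z ∈ D, ((Fam z : (quasiSplit (↥(maximalRealSubfield L)) L (IsCMField.complexConj L) 3).L2 μ) : (quasiSplit (↥(maximalRealSubfield L)) L (IsCMField.complexConj L) 3).automorphicQuotient → ℂ) =ᵐ[μ] (quasiSplit (↥(maximalRealSubfield L)) L (IsCMField.complexConj L) 3).quotFun (truncation ν 𝓕 T (Ec z))) ∧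
        ∃ C : ℝ, ∀ᶠ z in 𝓝[≠] ((3 : ℂ) / 2), ‖(z - (3 : ℂ) / 2) • Fam z‖ ≤ C)
    (hCT : ∀ (L : Type) [Field L] [NumberField L] [IsCMField L]
      [MeasurableSpace (quasiSplit (↥(maximalRealSubfield L)) L (IsCMField.complexConj L) 3).Adelic] [BorelSpace (quasiSplit (↥(maximalRealSubfield L)) L (IsCMField.complexConj L) 3).Adelic]
      (μ : Measure (quasiSplit (↥(maximalRealSubfield L)) L (IsCMField.complexConj L) 3).automorphicQuotient) [(quasiSplit (↥(maximalRealSubfield L)) L (IsCMField.complexConj L) 3).IsAutomorphicMeasure μ]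
      (𝔓 : (quasiSplit (↥(maximalRealSubfield L)) L (IsCMField.complexConj L) 3).ParabolicUnipotentData) (_ : ∀ j : 𝔓.ι, 𝔓.radical j = adelicUnipotent (↥(maximalRealSubfield L)) L (IsCMField.complexConj L) 3)
      (μω : HeckeCharacter L) (_ : μω.IsUnitary)
      (_ : ∀ x : Literature.NumberTheory.GaloisRepresentations.ideleGroup ↥(maximalRealSubfield L),
        μω (AdeleRing.ideleBaseChange (↥(maximalRealSubfield L)) L x) = quadraticHeckeCharCM L x)
      (ξ : OneDimAutRepH L) (K' : Subgroup (quasiSplit (↥(maximalRealSubfield L)) L (IsCMField.complexConj L) 3).Adelic) (ω : ↥K' →* ℂ)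
      (φ : (quasiSplit (↥(maximalRealSubfield L)) L (IsCMField.complexConj L) 3).Adelic → ℂ) (_ : φ ∈ chiSectionSpacePair (ξ.bcη⁻¹ * ξ.bcψ⁻¹ * μω) ξ.ψ K' (ω : ↥K' → ℂ)) (_ : Continuous φ)
      (Ec : ℂ → (quasiSplit (↥(maximalRealSubfield L)) L (IsCMField.complexConj L) 3).Adelic → ℂ) (Sp : Finset ℂ) (_ : ∀ s ∈ Sp, s.im = 0 ∧ 1 < s.re ∧ s.re ≤ 2)
      (_ : ∀ g, DifferentiableOn ℂ (fun z => Ec z g) ({z : ℂ | 1 < z.re} \ (↑Sp : Set ℂ)))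
      (_ : ∀ z : ℂ, 2 < z.re → Ec z = eisensteinSeriesU (flatSectionU φ z))
      (Fp : (quasiSplit (↥(maximalRealSubfield L)) L (IsCMField.complexConj L) 3).Adelic → ℂ → ℂ) (_ : ∀ g, AnalyticAt ℂ (Fp g) ((3 : ℂ) / 2))
      (_ : ∀ g, Fp g =ᶠ[𝓝[≠] ((3 : ℂ) / 2)] fun z => (z - (3 : ℂ) / 2) * Ec z g)
      (f : (quasiSplit (↥(maximalRealSubfield L)) L (IsCMField.complexConj L) 3).L2 μ) (_ : (f : (quasiSplit (↥(maximalRealSubfield L)) L (IsCMField.complexConj L) 3).automorphicQuotient → ℂ) =ᵐ[μ] fun x => Fp (Quotient.out (x : (quasiSplit (↥(maximalRealSubfield L)) L (IsCMField.complexConj L) 3).Adelic ⧸ (quasiSplit (↥(maximalRealSubfield L)) L (IsCMField.complexConj L) 3).quotientSubgroup))⁻¹ ((3 : ℂ) / 2))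
      (ν : Measure ↥(adelicUnipotent (↥(maximalRealSubfield L)) L (IsCMField.complexConj L) 3)) (_ : ν.IsHaarMeasure) (𝓕 : Set ↥(adelicUnipotent (↥(maximalRealSubfield L)) L (IsCMField.complexConj L) 3)) (_ : IsFundamentalDomain ↥(rationalUnipotent (↥(maximalRealSubfield L)) L (IsCMField.complexConj L) 3) 𝓕 ν) (_ : IsCompact (closure 𝓕)),
      ∃ (φ₀ : (quasiSplit (↥(maximalRealSubfield L)) L (IsCMField.complexConj L) 3).Adelic → ℂ) (ψ : ℂ → (quasiSplit (↥(maximalRealSubfield L)) L (IsCMField.complexConj L) 3).Adelic → ℂ) (ρψ : (quasiSplit (↥(maximalRealSubfield L)) L (IsCMField.complexConj L) 3).Adelic → ℂ),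
        (∀ z ∈ ({z : ℂ | 1 < z.re} \ (↑Sp : Set ℂ)), ∀ g : (quasiSplit (↥(maximalRealSubfield L)) L (IsCMField.complexConj L) 3).Adelic,
          borelConstantTerm ν 𝓕 (Ec z) g = φ₀ g * (((borelHeight g : ℝ≥0) : ℝ) : ℂ) ^ z + ψ z g * (((borelHeight g : ℝ≥0) : ℝ) : ℂ) ^ (2 - z)) ∧
        (∀ g, Tendsto (fun z : ℂ => (z - (3 : ℂ) / 2) * ψ z g) (𝓝[≠] ((3 : ℂ) / 2)) (𝓝 (ρψ g))) ∧
        Measurable (fun g : (quasiSplit (↥(maximalRealSubfield L)) L (IsCMField.complexConj L) 3).Adelic => ρψ g * (((borelHeight g : ℝ≥0) : ℝ) : ℂ) ^ (2 - (3 : ℂ) / 2)) ∧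
        (∀ b ∈ arithmeticBorel (↥(maximalRealSubfield L)) L (IsCMField.complexConj L) 3, ∀ x : (quasiSplit (↥(maximalRealSubfield L)) L (IsCMField.complexConj L) 3).Adelic, (fun g : (quasiSplit (↥(maximalRealSubfield L)) L (IsCMField.complexConj L) 3).Adelic => ρψ g * (((borelHeight g : ℝ≥0) : ℝ) : ℂ) ^ (2 - (3 : ℂ) / 2)) ((b : (quasiSplit (↥(maximalRealSubfield L)) L (IsCMField.complexConj L) 3).Adelic) * x) = (fun g : (quasiSplit (↥(maximalRealSubfield L)) L (IsCMField.complexConj L) 3).Adelic => ρψ g * (((borelHeight g : ℝ≥0) : ℝ) : ℂ) ^ (2 - (3 : ℂ) / 2)) x) ∧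
        (∀ (u : ↥(adelicUnipotent (↥(maximalRealSubfield L)) L (IsCMField.complexConj L) 3)) (g : (quasiSplit (↥(maximalRealSubfield L)) L (IsCMField.complexConj L) 3).Adelic), (fun g : (quasiSplit (↥(maximalRealSubfield L)) L (IsCMField.complexConj L) 3).Adelic => ρψ g * (((borelHeight g : ℝ≥0) : ℝ) : ℂ) ^ (2 - (3 : ℂ) / 2)) ((u : (quasiSplit (↥(maximalRealSubfield L)) L (IsCMField.complexConj L) 3).Adelic) * g) = (fun g : (quasiSplit (↥(maximalRealSubfield L)) L (IsCMField.complexConj L) 3).Adelic => ρψ g * (((borelHeight g : ℝ≥0) : ℝ) : ℂ) ^ (2 - (3 : ℂ) / 2)) g) ∧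
        ∃ K : ℝ, ∀ g : (quasiSplit (↥(maximalRealSubfield L)) L (IsCMField.complexConj L) 3).Adelic, ‖(fun g : (quasiSplit (↥(maximalRealSubfield L)) L (IsCMField.complexConj L) 3).Adelic => ρψ g * (((borelHeight g : ℝ≥0) : ℝ) : ℂ) ^ (2 - (3 : ℂ) / 2)) g‖ ≤ K * ((borelHeight g : ℝ≥0) : ℝ) ^ (1 / 2 : ℝ)) :
    ∀ (L : Type) [Field L] [NumberField L] [IsCMField L]
      [MeasurableSpace (quasiSplit (↥(maximalRealSubfield L)) L (IsCMField.complexConj L) 3).Adelic] [BorelSpace (quasiSplit (↥(maximalRealSubfield L)) L (IsCMField.complexConj L) 3).Adelic]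
      (μ : Measure (quasiSplit (↥(maximalRealSubfield L)) L (IsCMField.complexConj L) 3).automorphicQuotient) [(quasiSplit (↥(maximalRealSubfield L)) L (IsCMField.complexConj L) 3).IsAutomorphicMeasure μ]
      (𝔓 : (quasiSplit (↥(maximalRealSubfield L)) L (IsCMField.complexConj L) 3).ParabolicUnipotentData) (_ : ∀ j : 𝔓.ι, 𝔓.radical j = adelicUnipotent (↥(maximalRealSubfield L)) L (IsCMField.complexConj L) 3) (_ : Nonempty 𝔓.ι)
      (μω : HeckeCharacter L) (_ : μω.IsUnitary)
      (_ : ∀ x : Literature.NumberTheory.GaloisRepresentations.ideleGroup ↥(maximalRealSubfield L),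
        μω (AdeleRing.ideleBaseChange (↥(maximalRealSubfield L)) L x) = quadraticHeckeCharCM L x)
      (ξ : OneDimAutRepH L) (K' : Subgroup (quasiSplit (↥(maximalRealSubfield L)) L (IsCMField.complexConj L) 3).Adelic) (ω : ↥K' →* ℂ)
      (φ : (quasiSplit (↥(maximalRealSubfield L)) L (IsCMField.complexConj L) 3).Adelic → ℂ) (_ : φ ∈ chiSectionSpacePair (ξ.bcη⁻¹ * ξ.bcψ⁻¹ * μω) ξ.ψ K' (ω : ↥K' → ℂ)) (_ : Continuous φ)
      (Ec : ℂ → (quasiSplit (↥(maximalRealSubfield L)) L (IsCMField.complexConj L) 3).Adelic → ℂ) (Sp : Finset ℂ) (_ : ∀ s ∈ Sp, s.im = 0 ∧ 1 < s.re ∧ s.re ≤ 2)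
      (_ : ∀ g, DifferentiableOn ℂ (fun z => Ec z g) ({z : ℂ | 1 < z.re} \ (↑Sp : Set ℂ)))
      (_ : ∀ z : ℂ, 2 < z.re → Ec z = eisensteinSeriesU (flatSectionU φ z))
      (Fp : (quasiSplit (↥(maximalRealSubfield L)) L (IsCMField.complexConj L) 3).Adelic → ℂ → ℂ) (_ : ∀ g, AnalyticAt ℂ (Fp g) ((3 : ℂ) / 2))
      (_ : ∀ g, Fp g =ᶠ[𝓝[≠] ((3 : ℂ) / 2)] fun z => (z - (3 : ℂ) / 2) * Ec z g)
      (f : (quasiSplit (↥(maximalRealSubfield L)) L (IsCMField.complexConj L) 3).L2 μ) (_ : (f : (quasiSplit (↥(maximalRealSubfield L)) L (IsCMField.complexConj L) 3).automorphicQuotient → ℂ) =ᵐ[μ] fun x => Fp (Quotient.out (x : (quasiSplit (↥(maximalRealSubfield L)) L (IsCMField.complexConj L) 3).Adelic ⧸ (quasiSplit (↥(maximalRealSubfield L)) L (IsCMField.complexConj L) 3).quotientSubgroup))⁻¹ ((3 : ℂ) / 2))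
      (ν : Measure ↥(adelicUnipotent (↥(maximalRealSubfield L)) L (IsCMField.complexConj L) 3)) (_ : ν.IsHaarMeasure) (𝓕 : Set ↥(adelicUnipotent (↥(maximalRealSubfield L)) L (IsCMField.complexConj L) 3)) (_ : IsFundamentalDomain ↥(rationalUnipotent (↥(maximalRealSubfield L)) L (IsCMField.complexConj L) 3) 𝓕 ν) (_ : IsCompact (closure 𝓕)),
      ∃ (T : ℝ≥0) (_ : 1 ≤ T) (D : Set ℂ) (σ₀ : ℝ) (Fam : ℂ → (quasiSplit (↥(maximalRealSubfield L)) L (IsCMField.complexConj L) 3).L2 μ) (corr : (quasiSplit (↥(maximalRealSubfield L)) L (IsCMField.complexConj L) 3).L2 μ),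
        IsOpen D ∧ IsPreconnected D ∧ DifferentiableOn ℂ Fam D ∧ 2 < σ₀ ∧ (∀ᶠ z in 𝓝 ((σ₀ : ℝ) : ℂ), z ∈ D) ∧ (∀ᶠ z in 𝓝[≠] ((3 : ℂ) / 2), z ∈ D) ∧
        (∀ z ∈ D, ((Fam z : (quasiSplit (↥(maximalRealSubfield L)) L (IsCMField.complexConj L) 3).L2 μ) : (quasiSplit (↥(maximalRealSubfield L)) L (IsCMField.complexConj L) 3).automorphicQuotient → ℂ) =ᵐ[μ] (quasiSplit (↥(maximalRealSubfield L)) L (IsCMField.complexConj L) 3).quotFun (truncation ν 𝓕 T (Ec z))) ∧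
        Tendsto (fun z : ℂ => (z - (3 : ℂ) / 2) • Fam z + corr) (𝓝[≠] ((3 : ℂ) / 2)) (𝓝 f) ∧
        ∀ φc : ↥((quasiSplit (↥(maximalRealSubfield L)) L (IsCMField.complexConj L) 3).cuspForms μ 𝔓), ⟪(quasiSplit (↥(maximalRealSubfield L)) L (IsCMField.complexConj L) 3).cuspFormsToLp μ 𝔓 φc, corr⟫_ℂ = 0 := by
  intro L _ _ _ _ _ μ _ 𝔓 h𝔓 hne μω hμu hquad ξ K' ω φ hφV hφc Ec Sp hSp hhol hEis Fp hFp hFpE f hf ν hν 𝓕 h𝓕N h𝓕c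
  obtain ⟨i⟩ := hne
  obtain ⟨T, hT, D, σ₀, Fam, hDo, hDc, hDsub, hFd, hσ₀, hσD, hD32, hFam, hMS⟩ :=
    hROAD L μ 𝔓 h𝔓 μω hμu hquad ξ K' ω φ hφV hφc Ec Sp hSp hhol hEis Fp hFp hFpE f hf ν hν 𝓕 h𝓕N h𝓕c
  obtain ⟨φ₀, ψ, ρψ, hE3, hψ, hψm, hψB, hψN, K, hψK⟩ :=
    hCT L μ 𝔓 h𝔓 μω hμu hquad ξ K' ω φ hφV hφc Ec Sp hSp hhol hEis Fp hFp hFpE f hf ν hν 𝓕 h𝓕N h𝓕c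
  exact opRoadPackage_of_letters L μ 𝔓 ξ μω i (h𝔓 i) hφV Ec hSp hhol hEis Fp hFp hFpE f hf ν h𝓕N h𝓕c hT Fam hDo hDc hDsub hFd hσ₀ hσD hD32 hFam hMS
    φ₀ ψ ρψ hE3 hψ hψm hψB hψN hψK

/-! ## §3 (R)′ over {L1, ℓ-ROAD, ℓ-CT}: ★ p863331's spine with §2 as its operator road -/

/-- **(R)′ OVER THE THREE LETTERS L1 `hDISC`, ℓ-ROAD `hROAD`, ℓ-CT `hCT`** — the conclusion bytes of ★ p863331 `res_midBlock_le_residual_of_letters` ((R) :284 + `Nonempty 𝔓.ι`); proof = ★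
p863331's spine (★ p862884 ∘ {★ `hdisc_of_admissible`, ★ `hcuspLetters_of_operatorRoad`}) with the operator road supplied by §2 at the frame's own `hne`.
[cite: MoeglinWaldspurger1995, I.2.18, IV.1.11, V.3.13] [cite: Rogawski1990, §13.9 p. 229 (ii)] -/
theorem res_midBlock_le_residual_of_letters'
    (hDISC : ∀ (L : Type) [Field L] [NumberField L] [IsCMField L]
      (μ : Measure (quasiSplit (↥(maximalRealSubfield L)) L (IsCMField.complexConj L) 3).automorphicQuotient) [(quasiSplit (↥(maximalRealSubfield L)) L (IsCMField.complexConj L) 3).IsAutomorphicMeasure μ]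
      (μω : HeckeCharacter L) (_ : μω.IsUnitary) (ξ : OneDimAutRepH L), ∀ (E : Submodule ℂ (resGMidBlock L μ ξ μω).toSubmodule)
          (hE : ∀ k, ∀ x ∈ E, ((resGMidBlock L μ ξ μω).toContRep.restrict (((standardMaximalCompactGL 3 L).comap (adelicVal (↥(maximalRealSubfield L)) L (IsCMField.complexConj L) 3 ((StdForm.antidiagonal 3).over L)) : Subgroup (quasiSplit (↥(maximalRealSubfield L)) L (IsCMField.complexConj L) 3).Adelic)).subtype) k x ∈ E), FiniteDimensional ℂ E →
          (((resGMidBlock L μ ξ μω).toContRep.restrict (((standardMaximalCompactGL 3 L).comap (adelicVal (↥(maximalRealSubfield L)) L (IsCMField.complexConj L) 3 ((StdForm.antidiagonal 3).over L)) : Subgroup (quasiSplit (↥(maximalRealSubfield L)) L (IsCMField.complexConj L) 3).Adelic)).subtype).subRep E hE).IsIrreducible →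
          FiniteDimensional ℂ (Representation.homRangeSum ((resGMidBlock L μ ξ μω).toContRep.restrict (((standardMaximalCompactGL 3 L).comap (adelicVal (↥(maximalRealSubfield L)) L (IsCMField.complexConj L) 3 ((StdForm.antidiagonal 3).over L)) : Subgroup (quasiSplit (↥(maximalRealSubfield L)) L (IsCMField.complexConj L) 3).Adelic)).subtype).toRepresentation (((resGMidBlock L μ ξ μω).toContRep.restrict (((standardMaximalCompactGL 3 L).comap (adelicVal (↥(maximalRealSubfield L)) L (IsCMField.complexConj L) 3 ((StdForm.antidiagonal 3).over L)) : Subgroup (quasiSplit (↥(maximalRealSubfield L)) L (IsCMField.complexConj L) 3).Adelic)).subtype).subRep E hE)))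
    (hROAD : ∀ (L : Type) [Field L] [NumberField L] [IsCMField L]
      [MeasurableSpace (quasiSplit (↥(maximalRealSubfield L)) L (IsCMField.complexConj L) 3).Adelic] [BorelSpace (quasiSplit (↥(maximalRealSubfield L)) L (IsCMField.complexConj L) 3).Adelic]
      (μ : Measure (quasiSplit (↥(maximalRealSubfield L)) L (IsCMField.complexConj L) 3).automorphicQuotient) [(quasiSplit (↥(maximalRealSubfield L)) L (IsCMField.complexConj L) 3).IsAutomorphicMeasure μ]
      (𝔓 : (quasiSplit (↥(maximalRealSubfield L)) L (IsCMField.complexConj L) 3).ParabolicUnipotentData) (_ : ∀ j : 𝔓.ι, 𝔓.radical j = adelicUnipotent (↥(maximalRealSubfield L)) L (IsCMField.complexConj L) 3)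
      (μω : HeckeCharacter L) (_ : μω.IsUnitary)
      (_ : ∀ x : Literature.NumberTheory.GaloisRepresentations.ideleGroup ↥(maximalRealSubfield L),
        μω (AdeleRing.ideleBaseChange (↥(maximalRealSubfield L)) L x) = quadraticHeckeCharCM L x)
      (ξ : OneDimAutRepH L) (K' : Subgroup (quasiSplit (↥(maximalRealSubfield L)) L (IsCMField.complexConj L) 3).Adelic) (ω : ↥K' →* ℂ)
      (φ : (quasiSplit (↥(maximalRealSubfield L)) L (IsCMField.complexConj L) 3).Adelic → ℂ) (_ : φ ∈ chiSectionSpacePair (ξ.bcη⁻¹ * ξ.bcψ⁻¹ * μω) ξ.ψ K' (ω : ↥K' → ℂ)) (_ : Continuous φ)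
      (Ec : ℂ → (quasiSplit (↥(maximalRealSubfield L)) L (IsCMField.complexConj L) 3).Adelic → ℂ) (Sp : Finset ℂ) (_ : ∀ s ∈ Sp, s.im = 0 ∧ 1 < s.re ∧ s.re ≤ 2)
      (_ : ∀ g, DifferentiableOn ℂ (fun z => Ec z g) ({z : ℂ | 1 < z.re} \ (↑Sp : Set ℂ)))
      (_ : ∀ z : ℂ, 2 < z.re → Ec z = eisensteinSeriesU (flatSectionU φ z))
      (Fp : (quasiSplit (↥(maximalRealSubfield L)) L (IsCMField.complexConj L) 3).Adelic → ℂ → ℂ) (_ : ∀ g, AnalyticAt ℂ (Fp g) ((3 : ℂ) / 2))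
      (_ : ∀ g, Fp g =ᶠ[𝓝[≠] ((3 : ℂ) / 2)] fun z => (z - (3 : ℂ) / 2) * Ec z g)
      (f : (quasiSplit (↥(maximalRealSubfield L)) L (IsCMField.complexConj L) 3).L2 μ) (_ : (f : (quasiSplit (↥(maximalRealSubfield L)) L (IsCMField.complexConj L) 3).automorphicQuotient → ℂ) =ᵐ[μ] fun x => Fp (Quotient.out (x : (quasiSplit (↥(maximalRealSubfield L)) L (IsCMField.complexConj L) 3).Adelic ⧸ (quasiSplit (↥(maximalRealSubfield L)) L (IsCMField.complexConj L) 3).quotientSubgroup))⁻¹ ((3 : ℂ) / 2))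
      (ν : Measure ↥(adelicUnipotent (↥(maximalRealSubfield L)) L (IsCMField.complexConj L) 3)) (_ : ν.IsHaarMeasure) (𝓕 : Set ↥(adelicUnipotent (↥(maximalRealSubfield L)) L (IsCMField.complexConj L) 3)) (_ : IsFundamentalDomain ↥(rationalUnipotent (↥(maximalRealSubfield L)) L (IsCMField.complexConj L) 3) 𝓕 ν) (_ : IsCompact (closure 𝓕)),
      ∃ (T : ℝ≥0) (_ : 1 ≤ T) (D : Set ℂ) (σ₀ : ℝ) (Fam : ℂ → (quasiSplit (↥(maximalRealSubfield L)) L (IsCMField.complexConj L) 3).L2 μ),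
        IsOpen D ∧ IsPreconnected D ∧ D ⊆ ({z : ℂ | 1 < z.re} \ (↑Sp : Set ℂ)) ∧ DifferentiableOn ℂ Fam D ∧ 2 < σ₀ ∧ (∀ᶠ z in 𝓝 ((σ₀ : ℝ) : ℂ), z ∈ D) ∧ (∀ᶠ z in 𝓝[≠] ((3 : ℂ) / 2), z ∈ D) ∧
        (∀ z ∈ D, ((Fam z : (quasiSplit (↥(maximalRealSubfield L)) L (IsCMField.complexConj L) 3).L2 μ) : (quasiSplit (↥(maximalRealSubfield L)) L (IsCMField.complexConj L) 3).automorphicQuotient → ℂ) =ᵐ[μ] (quasiSplit (↥(maximalRealSubfield L)) L (IsCMField.complexConj L) 3).quotFun (truncation ν 𝓕 T (Ec z))) ∧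
        ∃ C : ℝ, ∀ᶠ z in 𝓝[≠] ((3 : ℂ) / 2), ‖(z - (3 : ℂ) / 2) • Fam z‖ ≤ C)
    (hCT : ∀ (L : Type) [Field L] [NumberField L] [IsCMField L]
      [MeasurableSpace (quasiSplit (↥(maximalRealSubfield L)) L (IsCMField.complexConj L) 3).Adelic] [BorelSpace (quasiSplit (↥(maximalRealSubfield L)) L (IsCMField.complexConj L) 3).Adelic]
      (μ : Measure (quasiSplit (↥(maximalRealSubfield L)) L (IsCMField.complexConj L) 3).automorphicQuotient) [(quasiSplit (↥(maximalRealSubfield L)) L (IsCMField.complexConj L) 3).IsAutomorphicMeasure μ]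
      (𝔓 : (quasiSplit (↥(maximalRealSubfield L)) L (IsCMField.complexConj L) 3).ParabolicUnipotentData) (_ : ∀ j : 𝔓.ι, 𝔓.radical j = adelicUnipotent (↥(maximalRealSubfield L)) L (IsCMField.complexConj L) 3)
      (μω : HeckeCharacter L) (_ : μω.IsUnitary)
      (_ : ∀ x : Literature.NumberTheory.GaloisRepresentations.ideleGroup ↥(maximalRealSubfield L),
        μω (AdeleRing.ideleBaseChange (↥(maximalRealSubfield L)) L x) = quadraticHeckeCharCM L x)
      (ξ : OneDimAutRepH L) (K' : Subgroup (quasiSplit (↥(maximalRealSubfield L)) L (IsCMField.complexConj L) 3).Adelic) (ω : ↥K' →* ℂ)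
      (φ : (quasiSplit (↥(maximalRealSubfield L)) L (IsCMField.complexConj L) 3).Adelic → ℂ) (_ : φ ∈ chiSectionSpacePair (ξ.bcη⁻¹ * ξ.bcψ⁻¹ * μω) ξ.ψ K' (ω : ↥K' → ℂ)) (_ : Continuous φ)
      (Ec : ℂ → (quasiSplit (↥(maximalRealSubfield L)) L (IsCMField.complexConj L) 3).Adelic → ℂ) (Sp : Finset ℂ) (_ : ∀ s ∈ Sp, s.im = 0 ∧ 1 < s.re ∧ s.re ≤ 2)
      (_ : ∀ g, DifferentiableOn ℂ (fun z => Ec z g) ({z : ℂ | 1 < z.re} \ (↑Sp : Set ℂ)))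
      (_ : ∀ z : ℂ, 2 < z.re → Ec z = eisensteinSeriesU (flatSectionU φ z))
      (Fp : (quasiSplit (↥(maximalRealSubfield L)) L (IsCMField.complexConj L) 3).Adelic → ℂ → ℂ) (_ : ∀ g, AnalyticAt ℂ (Fp g) ((3 : ℂ) / 2))
      (_ : ∀ g, Fp g =ᶠ[𝓝[≠] ((3 : ℂ) / 2)] fun z => (z - (3 : ℂ) / 2) * Ec z g)
      (f : (quasiSplit (↥(maximalRealSubfield L)) L (IsCMField.complexConj L) 3).L2 μ) (_ : (f : (quasiSplit (↥(maximalRealSubfield L)) L (IsCMField.complexConj L) 3).automorphicQuotient → ℂ) =ᵐ[μ] fun x => Fp (Quotient.out (x : (quasiSplit (↥(maximalRealSubfield L)) L (IsCMField.complexConj L) 3).Adelic ⧸ (quasiSplit (↥(maximalRealSubfield L)) L (IsCMField.complexConj L) 3).quotientSubgroup))⁻¹ ((3 : ℂ) / 2))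
      (ν : Measure ↥(adelicUnipotent (↥(maximalRealSubfield L)) L (IsCMField.complexConj L) 3)) (_ : ν.IsHaarMeasure) (𝓕 : Set ↥(adelicUnipotent (↥(maximalRealSubfield L)) L (IsCMField.complexConj L) 3)) (_ : IsFundamentalDomain ↥(rationalUnipotent (↥(maximalRealSubfield L)) L (IsCMField.complexConj L) 3) 𝓕 ν) (_ : IsCompact (closure 𝓕)),
      ∃ (φ₀ : (quasiSplit (↥(maximalRealSubfield L)) L (IsCMField.complexConj L) 3).Adelic → ℂ) (ψ : ℂ → (quasiSplit (↥(maximalRealSubfield L)) L (IsCMField.complexConj L) 3).Adelic → ℂ) (ρψ : (quasiSplit (↥(maximalRealSubfield L)) L (IsCMField.complexConj L) 3).Adelic → ℂ),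
        (∀ z ∈ ({z : ℂ | 1 < z.re} \ (↑Sp : Set ℂ)), ∀ g : (quasiSplit (↥(maximalRealSubfield L)) L (IsCMField.complexConj L) 3).Adelic,
          borelConstantTerm ν 𝓕 (Ec z) g = φ₀ g * (((borelHeight g : ℝ≥0) : ℝ) : ℂ) ^ z + ψ z g * (((borelHeight g : ℝ≥0) : ℝ) : ℂ) ^ (2 - z)) ∧
        (∀ g, Tendsto (fun z : ℂ => (z - (3 : ℂ) / 2) * ψ z g) (𝓝[≠] ((3 : ℂ) / 2)) (𝓝 (ρψ g))) ∧
        Measurable (fun g : (quasiSplit (↥(maximalRealSubfield L)) L (IsCMField.complexConj L) 3).Adelic => ρψ g * (((borelHeight g : ℝ≥0) : ℝ) : ℂ) ^ (2 - (3 : ℂ) / 2)) ∧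
        (∀ b ∈ arithmeticBorel (↥(maximalRealSubfield L)) L (IsCMField.complexConj L) 3, ∀ x : (quasiSplit (↥(maximalRealSubfield L)) L (IsCMField.complexConj L) 3).Adelic, (fun g : (quasiSplit (↥(maximalRealSubfield L)) L (IsCMField.complexConj L) 3).Adelic => ρψ g * (((borelHeight g : ℝ≥0) : ℝ) : ℂ) ^ (2 - (3 : ℂ) / 2)) ((b : (quasiSplit (↥(maximalRealSubfield L)) L (IsCMField.complexConj L) 3).Adelic) * x) = (fun g : (quasiSplit (↥(maximalRealSubfield L)) L (IsCMField.complexConj L) 3).Adelic => ρψ g * (((borelHeight g : ℝ≥0) : ℝ) : ℂ) ^ (2 - (3 : ℂ) / 2)) x) ∧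
        (∀ (u : ↥(adelicUnipotent (↥(maximalRealSubfield L)) L (IsCMField.complexConj L) 3)) (g : (quasiSplit (↥(maximalRealSubfield L)) L (IsCMField.complexConj L) 3).Adelic), (fun g : (quasiSplit (↥(maximalRealSubfield L)) L (IsCMField.complexConj L) 3).Adelic => ρψ g * (((borelHeight g : ℝ≥0) : ℝ) : ℂ) ^ (2 - (3 : ℂ) / 2)) ((u : (quasiSplit (↥(maximalRealSubfield L)) L (IsCMField.complexConj L) 3).Adelic) * g) = (fun g : (quasiSplit (↥(maximalRealSubfield L)) L (IsCMField.complexConj L) 3).Adelic => ρψ g * (((borelHeight g : ℝ≥0) : ℝ) : ℂ) ^ (2 - (3 : ℂ) / 2)) g) ∧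
        ∃ K : ℝ, ∀ g : (quasiSplit (↥(maximalRealSubfield L)) L (IsCMField.complexConj L) 3).Adelic, ‖(fun g : (quasiSplit (↥(maximalRealSubfield L)) L (IsCMField.complexConj L) 3).Adelic => ρψ g * (((borelHeight g : ℝ≥0) : ℝ) : ℂ) ^ (2 - (3 : ℂ) / 2)) g‖ ≤ K * ((borelHeight g : ℝ≥0) : ℝ) ^ (1 / 2 : ℝ)) :
    ∀ (L : Type) [Field L] [NumberField L] [IsCMField L]
      (μ : Measure (quasiSplit (↥(maximalRealSubfield L)) L (IsCMField.complexConj L) 3).automorphicQuotient) [(quasiSplit (↥(maximalRealSubfield L)) L (IsCMField.complexConj L) 3).IsAutomorphicMeasure μ]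
      (𝔓 : (quasiSplit (↥(maximalRealSubfield L)) L (IsCMField.complexConj L) 3).ParabolicUnipotentData) (_ : ∀ j : 𝔓.ι, 𝔓.radical j = adelicUnipotent (↥(maximalRealSubfield L)) L (IsCMField.complexConj L) 3) (_ : Nonempty 𝔓.ι)
      (μω : HeckeCharacter L) (_ : μω.IsUnitary),
      (∀ x : Literature.NumberTheory.GaloisRepresentations.ideleGroup ↥(maximalRealSubfield L),
        μω (AdeleRing.ideleBaseChange (↥(maximalRealSubfield L)) L x) = quadraticHeckeCharCM L x) →
      ∀ (ξ : OneDimAutRepH L), resGMidBlock L μ ξ μω ≤ residualSubspace (quasiSplit (↥(maximalRealSubfield L)) L (IsCMField.complexConj L) 3) μ 𝔓 := by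
  intro L _ _ _ μ _ 𝔓 h𝔓 hne μω hμu hquad ξ
  letI : MeasurableSpace (quasiSplit (↥(maximalRealSubfield L)) L (IsCMField.complexConj L) 3).Adelic := borel _
  haveI : BorelSpace (quasiSplit (↥(maximalRealSubfield L)) L (IsCMField.complexConj L) 3).Adelic := ⟨rfl⟩
  obtain ⟨ν, 𝓕, hν, -, -, h𝓕N, h𝓕c, -, -⟩ := exists_unipotent_haar_fundamentalDomain_cm_three L
  haveI := hν
  obtain ⟨i⟩ := hne
  exact resGMidBlock_le_residualSubspace_of_disc_of_cuspLetters L μ 𝔓 ξ μω (hdisc_of_admissible L μ ξ μω (hDISC L μ μω hμu ξ))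
    (hcuspLetters_of_operatorRoad L μ 𝔓 ξ μω ν h𝓕N h𝓕c i (h𝔓 i) hμu
      (fun K' ω φ hφV hφc Ec Sp hSp hhol hEis Fp hFp hFpE f hf =>
        hOP_of_letters hROAD hCT L μ 𝔓 h𝔓 ⟨i⟩ μω hμu hquad ξ K' ω φ hφV hφc Ec Sp hSp hhol hEis Fp hFp hFpE f hf ν hν 𝓕 h𝓕N h𝓕c))

end Summit.HodgeConjecture.HodgeConjecture.R90.S8

end
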